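import Literature.NumberTheory.ComplexMultiplication.CosetGermGaloisWeilOrbitTorus
import Literature.NumberTheory.ComplexMultiplication.SerreGroupOrbitToriHomomorphismOfField
import HarnessLib

/-!
# Milne 1999 §6 p. 71 L15–L17 FOR THE CM FIELD `K`: for EVERY `Γ`-orbit `Ψ` of CM types of `K` and its orbit `Π(Ψ)` of Weil germs, `K`'s own
# `X^*(T^Ψ)`, `X^*(L^{Π(Ψ)})`, `X^*(γ^Ψ)`, `X^*(β^Π)`, `X^*(α′)` ARE the model's summands of Lemma 6.10 (`I = Γ\{CM-types on K}`, `I′ = Γ\W^K_{1,+}(p^∞)`)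

THE PRINT. [Milne1999, §6 p. 71 L15–L17]: «Let `I = Γ\{CM-types on K}` and let `I′ = Γ\W^K_{1,+}(p^∞)`.  LEMMA 6.10. The square
`⊕_{Φ∈I} X^*(T^Φ) −γ→ X^*(S^K)` [over] `⊕_{Π∈I′} X^*(T^Π) −β→ X^*(P^K)` [verticals `α″`, `α`] is almost Cartesian.»  The summands and maps:
§2 p. 55 / §3 p. 59 L1–L8 («For any `Γ`-orbit `Ψ` of CM-types on `K`, the map `f ↦ Σ_{ψ∈Ψ} f(ψ)ψ : ℤ^Ψ → X^*(S^K)` factors through `X^*(T^Ψ)` and,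
hence, defines a homomorphism `γ^Ψ : S^K → T^Ψ`»), §4 p. 60 L22–L27 (`X^*(L^Π) = {f : Π → ℤ}/{f = ιf, Σ f(π) = 0}`, `l^Π`), p. 62 L17–L19 (`β^Π`),
§5 pp. 64–65 («The reduction functor … to each `Γ`-orbit `Ψ` of CM-types it attaches a `Γ`-orbit `Π(Ψ)` of Weil integers of weight `−1` and a
surjective `Γ`-equivariant homomorphism `Ψ → Π(Ψ)`», whence `X^*(T^Ψ) → X^*(L^{Π(Ψ)})`, `Σ f(ψ)ψ ↦ Σ f(ψ)π(ψ)`).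

DICTIONARY (tree ↔ print).  For the CM field `K` (namespace `CMNumbers`): CM types `Φ ⊂ Hom(K, ℚ^{cm})` (skel-3 `IsCMTypeWith ι_{cm}`), orbits
under `Gal(ℚ^{cm}/ℚ)`; g16-#6 `cmOrbitChar ℤ Φ₀ = X^*(T^Ψ)`, `tCM = t^Ψ`, `cmOrbitRep`; g16-#7 `gammaCharK = X^*(γ^Ψ)` (`[δ_Φ] ↦ λ_Φ`); g16-#6
`cmTypeGerm = π(Φ)`, `orbitRed : Ψ → Π(Ψ)`, `redChar = X^*(T^Ψ) → X^*(L^{Π(Ψ)})`; g15-#3 `weilOrbitChar ℤ ϖ = X^*(L^Π)`, `lWeil = l^Π`, `weilOrbitRep`;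
g16-#7 `betaCharIn = X^*(β^Π)` (`[δ_π] ↦ π`); g18-#2 `toGroupRing`/`serreLatticeEquiv : X^*(S^K) ↪ ℤ[Γ]` and `germToCosetFun : X^*(P^K) ↪ ℤ[Γ/D]`;
g18-#3 `toCMTypes τ₀ h : (CM types of K) → CMTypes h` («CM-types on `K`» read on `Γ = Hom(K, ℚ^{al})`).  The model (g17-#4, namespace `CosetGerm`,
for `h : Setting ι Γ₀ D`): `I = CMOrbits h`, `I′ = WeilOrbits R h`, `redI : I → I′`, the summands `CharModule R (c.orbit) ι` of `TSum`/`LSum`,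
`orbitToS c = X^*(T^c) → X^*(S^K)` (`[δ_Φ] ↦ 𝟙_Φ`), `orbitToP c′ = X^*(L^{c′}) → X^*(P^K)` (`[δ_π] ↦ f_π`), `redOrbit`/`pushOrbit c` (the summand of
`α″`).  HERE, for EVERY CM type `Φ₀` of `K` (`D` arbitrary on the `T`-side, `D = D(w₀) = decompositionGroup p 𝔭` on the `L`-side):
**`cmOrbitClass`** `= [Φ₀ on Γ] ∈ I`, **`cmOrbitEquiv : Ψ(K) ≃ [Φ₀ on Γ].orbit`** (`Φ ↦ Φ on Γ`), **`cmOrbitCharEquivModel : X^*(T^Ψ)(K) ≃ₗ[ℤ]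
CharModule ℤ ([Φ₀ on Γ].orbit) ι`**; **`weilOrbitClass`** `= redI [Φ₀ on Γ] = [red(Φ₀ on Γ)] ∈ I′`, **`weilOrbitEquiv : Π(Ψ)(K) ≃ [red(Φ₀ on
Γ)].orbit`** (`π ↦ f_π`), **`weilOrbitCharEquivModel : X^*(L^{Π(Ψ)})(K) ≃ₗ[ℤ] CharModule ℤ ([red(Φ₀ on Γ)].orbit) ι`**; and the three
intertwining identities **`toGroupRing_comp_gammaCharK`** (`γ ↔ orbitToS`), **`germToCosetFun_comp_betaCharIn`** (`β ↔ orbitToP`),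
**`weilOrbitCharEquivModel_comp_redChar`** (`α″ ↔ pushOrbit`).

WHAT IS HERE.  §1 (`T`-side): DEF `cmOrbitClass`, `toCMTypes_mem_orbit_cmOrbitClass`, DEF `cmOrbitMap` (`coe_cmOrbitMap`, **`cmOrbitMap_smul`**
(equivariance along `σ′ ↦ σ′|_K`), `cmOrbitMap_conj_smul`, `cmOrbitMap_injective`, `cmOrbitMap_surjective`), DEF **`cmOrbitEquiv`** (`cmOrbitEquiv_apply`),
DEF **`cmOrbitCharEquivModel`** (`…_mk_single`, **`…_tCM : t^Ψ ↦ [δ_{Φ₀} + δ_{ιΦ₀}]`**, **`…_cmOrbitRep`**), **`toGroupRing_comp_gammaCharK`**,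
`toGroupRing_gammaCharK`, `coe_serreLatticeEquiv_gammaCharK`.  §2 (`L`-side): DEF `weilOrbitClass` (`weilOrbitClass_eq`, `orbit_weilOrbitClass_eq`,
`red_toCMTypes_mem_orbit_weilOrbitClass`), `ofMul_smul_eq_weilLimitInRep`, **`germToCosetFun_ofMul_cmTypeGerm : f_{π(Φ)} = red(Φ on Γ)`**,
`germToCosetFun_ofMul_orbit`, DEF `weilOrbitMap` (`coe_coe_weilOrbitMap`, **`weilOrbitMap_smul`**, `weilOrbitMap_conj_smul`, `weilOrbitMap_base`,
`weilOrbitMap_injective`, `weilOrbitMap_surjective`), DEF **`weilOrbitEquiv`** (`weilOrbitEquiv_apply`), **`weilOrbitMap_orbitRed`** (`Ψ → Π(Ψ)` of `K` IS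
`redOrbit`), DEF **`weilOrbitCharEquivModel`** (`…_mk_single`, **`…_lWeil : l^Π ↦ [δ + ιδ]`**, **`…_weilOrbitRep`**), **`germToCosetFun_comp_betaCharIn`**,
`germToCosetFun_betaCharIn_eq_orbitToP`, **`weilOrbitCharEquivModel_comp_redChar`**, `weilOrbitCharEquivModel_redChar`.  Uses g18-#5's two-group
transport `OrbitTorus.congr₂`.

SCOPE / NOT HERE.  (1) The dictionaries are per orbit, for every orbit (no `n ≠ 2` needed: `Φ ↦ Φ on Γ` and `π ↦ f_π` are injective outright);
g18-#5 is the special reading of the orbit of `π₀` through `Π ≃ Γ/D` (Lemma 6.7).  (2) The index bijections `I(K) ≃ I`, `I′(K) ≃ I′` are g18-#3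
`toCMTypes_mem_orbit_iff` / g18-#4,5 at the level of orbits; the amalgamated `⊕_{Φ∈I}` / `⊕_{Π∈I′}` of `K`'s own modules, hence LEMMA 6.10 and
THEOREM 6.1 with `K`'s own `T`- and `L`-vertices, are NOT packaged here (model: g17-#4 `isAlmostCartesian_sum`, g17-#5 `exact_pairProduct`; `S`/`P`
for `K`: g18-#3 `exact_pairProduct_gal`).  (3) Nothing here is a case of the Hodge conjecture; Theorem 6.1 on group schemes / the limit over `K` is
Layer B (B5-09).

## References
* [Milne1999] J. S. Milne, *Lefschetz motives and the Tate conjecture*, Compositio Math. 117 (1999) 45–76, §6 p. 71 L15–L17 (Lemma 6.10), §§2–5.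

## Provenance
lit-hodgefound seat p27, generation 18, row g18-#6 (Milne 1999 §6 Lemma 6.10's summands and maps for the CM field `K`, per orbit).
-/

set_option autoImplicit false

noncomputable section

open scoped NumberField Pointwise

namespace Literature.NumberTheory.ComplexMultiplication

namespace CMNumbers

open _root_.NumberField IntermediateField Finset
open Literature.NumberTheory.NumberFields (cmNumbers cmNumbersConj cmNumbersConj_mul_comm)
open OrbitTorus (pushFun act)
open CosetGerm (Setting CMTypes CMOrbits WeilGerms WeilOrbits red ind)
open SerreGroupTorus (infinityTypesRep)

/-! ### §1 The `T`-side: `Ψ(K) ≃ Ψ(model)`, `X^*(T^Ψ)(K) ≅ CharModule ℤ Ψ ι`, `t^Ψ ↦ t`, and `X^*(γ^Ψ)(K)` IS `orbitToS` -/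

section TSide

variable {K : Type} [Field K] [NumberField K] [IsCMField K] [IsGalois ℚ K] (τ₀ : K →ₐ[ℚ] cmNumbers)
variable {Γ₀ D : Subgroup (K ≃ₐ[ℚ] K)} (h : Setting (conjGal : K ≃ₐ[ℚ] K) Γ₀ D) [DecidableEq (K ≃ₐ[ℚ] K)]
variable {Φ₀ : Set (K →ₐ[ℚ] cmNumbers)} (hΦ₀ : IsCMTypeWith (cmNumbersConj : cmNumbers ≃ₐ[ℚ] cmNumbers) Φ₀)

omit [IsGalois ℚ K] [DecidableEq (K ≃ₐ[ℚ] K)] in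
/-- **The class of `Ψ = ΓΦ₀` in `I = Γ\{CM-types on K}`** (g17-#4 `CosetGerm.CMOrbits h`, the CM types read on `Γ` by g18-#3 `toCMTypes`).
[cite: Milne1999, §6 p. 71 L15 («Let I = Γ\{CM-types on K}»)] -/
def cmOrbitClass : CMOrbits h := Quotient.mk'' (toCMTypes τ₀ h hΦ₀)

/-- Every `Φ ∈ Ψ = Gal(ℚ^{cm}/ℚ)·Φ₀`, read on `Γ`, lies in the class of `Φ₀` (g18-#3 `toCMTypes_mem_orbit_iff`). [cite: Milne1999, §6 p. 71 L15] -/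
theorem toCMTypes_mem_orbit_cmOrbitClass (Φ : MulAction.orbit (cmNumbers ≃ₐ[ℚ] cmNumbers) Φ₀) :
    toCMTypes τ₀ h (isCMTypeWith_of_mem_orbit hΦ₀ Φ) ∈ MulAction.orbitRel.Quotient.orbit (cmOrbitClass τ₀ h hΦ₀) :=
  (toCMTypes_mem_orbit_iff τ₀ h hΦ₀ (isCMTypeWith_of_mem_orbit hΦ₀ Φ)).2 Φ.2

/-- **`Ψ(K) → Ψ(model)`, `Φ ↦ (Φ read on Γ)`.** [cite: Milne1999, §6 p. 71 L15; §2 p. 55] -/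
def cmOrbitMap (Φ : MulAction.orbit (cmNumbers ≃ₐ[ℚ] cmNumbers) Φ₀) : MulAction.orbitRel.Quotient.orbit (cmOrbitClass τ₀ h hΦ₀) :=
  ⟨toCMTypes τ₀ h (isCMTypeWith_of_mem_orbit hΦ₀ Φ), toCMTypes_mem_orbit_cmOrbitClass τ₀ h hΦ₀ Φ⟩

/-- [cite: Milne1999, §6 p. 71 L15] -/
@[simp] theorem coe_cmOrbitMap (Φ : MulAction.orbit (cmNumbers ≃ₐ[ℚ] cmNumbers) Φ₀) :
    (cmOrbitMap τ₀ h hΦ₀ Φ).1 = toCMTypes τ₀ h (isCMTypeWith_of_mem_orbit hΦ₀ Φ) := rfl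

/-- **Equivariance along restriction**: `σ′Φ ↦ ρ·(Φ on Γ)` for `σ′ ∘ τ₀ = τ₀ ∘ ρ` (g18-#3 `toCMTypes_smul_set`). [cite: Milne1999, §6 p. 71 L15] -/
theorem cmOrbitMap_smul (σ' : cmNumbers ≃ₐ[ℚ] cmNumbers) (ρ : K ≃ₐ[ℚ] K) (hρ : σ' • τ₀ = embOfAut τ₀ ρ)
    (Φ : MulAction.orbit (cmNumbers ≃ₐ[ℚ] cmNumbers) Φ₀) : cmOrbitMap τ₀ h hΦ₀ (σ' • Φ) = ρ • cmOrbitMap τ₀ h hΦ₀ Φ :=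
  Subtype.ext (toCMTypes_smul_set τ₀ h (isCMTypeWith_of_mem_orbit hΦ₀ Φ) σ' ρ hρ)

/-- `ι_{cm}Φ ↦ ι·(Φ on Γ)`. [cite: Milne1999, §6 p. 71 L15] -/
theorem cmOrbitMap_conj_smul (Φ : MulAction.orbit (cmNumbers ≃ₐ[ℚ] cmNumbers) Φ₀) :
    cmOrbitMap τ₀ h hΦ₀ (cmNumbersConj • Φ) = (conjGal : K ≃ₐ[ℚ] K) • cmOrbitMap τ₀ h hΦ₀ Φ :=
  cmOrbitMap_smul τ₀ h hΦ₀ cmNumbersConj conjGal (cmNumbersConj_smul_eq_embOfAut_conjGal τ₀) Φ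

/-- [cite: Milne1999, §6 p. 71 L15] -/
theorem cmOrbitMap_injective : Function.Injective (cmOrbitMap τ₀ h hΦ₀) := fun Φ Φ' e =>
  Subtype.ext (toCMTypes_injective τ₀ h (isCMTypeWith_of_mem_orbit hΦ₀ Φ) (isCMTypeWith_of_mem_orbit hΦ₀ Φ') (congrArg Subtype.val e))

/-- [cite: Milne1999, §6 p. 71 L15] -/
theorem cmOrbitMap_surjective : Function.Surjective (cmOrbitMap τ₀ h hΦ₀) := by
  rintro ⟨S, hS⟩
  obtain ⟨ρ, rfl⟩ := MulAction.mem_orbit_iff.mp (show S ∈ MulAction.orbit (K ≃ₐ[ℚ] K) (toCMTypes τ₀ h hΦ₀) from hS)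
  obtain ⟨σ', hσ'⟩ := exists_smul_eq_embOfAut' τ₀ ρ
  refine ⟨σ' • ⟨Φ₀, MulAction.mem_orbit_self Φ₀⟩, ?_⟩
  rw [cmOrbitMap_smul τ₀ h hΦ₀ σ' ρ hσ']
  rfl

/-- **`Ψ(K) ≃ Ψ(model)`**: the `Gal(ℚ^{cm}/ℚ)`-orbit of a CM type `Φ₀` of `K` IS, read on `Γ` (`Φ ↦ {σ | τ₀σ ∈ Φ}`), the `Γ`-orbit class of `Φ₀` in
g17-#4's `I = Γ\{CM-types on K}`, compatibly with `ι_{cm} ↦ ι` and with restriction `σ′ ↦ σ′|_K`. [cite: Milne1999, §6 p. 71 L15; §2 p. 55] -/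
def cmOrbitEquiv : MulAction.orbit (cmNumbers ≃ₐ[ℚ] cmNumbers) Φ₀ ≃ MulAction.orbitRel.Quotient.orbit (cmOrbitClass τ₀ h hΦ₀) :=
  Equiv.ofBijective (cmOrbitMap τ₀ h hΦ₀) ⟨cmOrbitMap_injective τ₀ h hΦ₀, cmOrbitMap_surjective τ₀ h hΦ₀⟩

/-- [cite: Milne1999, §6 p. 71 L15] -/
@[simp] theorem cmOrbitEquiv_apply (Φ : MulAction.orbit (cmNumbers ≃ₐ[ℚ] cmNumbers) Φ₀) :
    cmOrbitEquiv τ₀ h hΦ₀ Φ = cmOrbitMap τ₀ h hΦ₀ Φ := rfl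

/-- **`X^*(T^Ψ)(K) IS THE MODEL'S `X^*(T^Ψ)`**: g16-#6's `cmOrbitChar ℤ Φ₀ = {f : Ψ → ℤ}/{f = ιf, Σ f = 0}` for the orbit `Ψ` of a CM type `Φ₀` of `K`
is, along `Ψ(K) ≃ Ψ(model)`, g17-#4's summand `CharModule ℤ (c.orbit) ι` of `⊕_{Φ∈I} X^*(T^Φ)` at `c = [Φ₀ on Γ]`. [cite: Milne1999, §6 p. 71
L15–L16; §2 p. 55 L38–L45] -/
def cmOrbitCharEquivModel :
    cmOrbitChar ℤ Φ₀ ≃ₗ[ℤ] OrbitTorus.CharModule ℤ (MulAction.orbitRel.Quotient.orbit (cmOrbitClass τ₀ h hΦ₀)) (conjGal : K ≃ₐ[ℚ] K) :=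
  OrbitTorus.congr₂ ℤ cmNumbersConj (conjGal : K ≃ₐ[ℚ] K) (cmOrbitEquiv τ₀ h hΦ₀) (cmOrbitMap_conj_smul τ₀ h hΦ₀)

/-- `[δ_Φ] ↦ [δ_{Φ on Γ}]`. [cite: Milne1999, §6 p. 71 L15–L16] -/
theorem cmOrbitCharEquivModel_mk_single (Φ : MulAction.orbit (cmNumbers ≃ₐ[ℚ] cmNumbers) Φ₀) (r : ℤ) :
    cmOrbitCharEquivModel τ₀ h hΦ₀ (Submodule.Quotient.mk (Finsupp.single Φ r)) =
      Submodule.Quotient.mk (Finsupp.single (cmOrbitMap τ₀ h hΦ₀ Φ) r) :=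
  OrbitTorus.congr₂_mk_single ℤ _ _ _ _ Φ r

/-- **`t^Ψ ↦ t`**: g16-#6's `tCM = [Φ₀ + ιΦ₀]` goes to the model's `[δ_{Φ₀} + δ_{ιΦ₀}]`. [cite: Milne1999, §6 p. 71 L15–L16; §2 p. 55 L45–L48] -/
theorem cmOrbitCharEquivModel_tCM :
    cmOrbitCharEquivModel τ₀ h hΦ₀ (tCM ℤ Φ₀) =
      OrbitTorus.tChar ℤ (conjGal : K ≃ₐ[ℚ] K) (⟨toCMTypes τ₀ h hΦ₀, CosetGerm.self_mem_orbit h _⟩ :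
        MulAction.orbitRel.Quotient.orbit (cmOrbitClass τ₀ h hΦ₀)) :=
  OrbitTorus.congr₂_tChar ℤ cmNumbersConj (conjGal : K ≃ₐ[ℚ] K) (cmOrbitEquiv τ₀ h hΦ₀) (cmOrbitMap_conj_smul τ₀ h hΦ₀) _

/-- **Equivariance** along `σ′ ↦ σ′|_K` (g16-#6 `cmOrbitRep` ↔ Q731 `OrbitTorus.rep`). [cite: Milne1999, §6 p. 71 L15–L16] -/
theorem cmOrbitCharEquivModel_cmOrbitRep (σ' : cmNumbers ≃ₐ[ℚ] cmNumbers) (ρ : K ≃ₐ[ℚ] K) (hρ : σ' • τ₀ = embOfAut τ₀ ρ)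
    (x : cmOrbitChar ℤ Φ₀) :
    cmOrbitCharEquivModel τ₀ h hΦ₀ (cmOrbitRep ℤ Φ₀ σ' x) =
      OrbitTorus.rep ℤ (MulAction.orbitRel.Quotient.orbit (cmOrbitClass τ₀ h hΦ₀)) (conjGal : K ≃ₐ[ℚ] K) h.comm ρ
        (cmOrbitCharEquivModel τ₀ h hΦ₀ x) :=
  OrbitTorus.congr₂_rep ℤ _ _ _ _ cmNumbersConj_mul_comm h.comm (cmOrbitMap_smul τ₀ h hΦ₀ σ' ρ hρ) x

/-- **`X^*(γ^Ψ)(K)` IS THE MODEL'S `X^*(T^c) → X^*(S^K)`**: g16-#7's `gammaCharK : X^*(T^Ψ) → X^*(S^K)`, `[δ_Φ] ↦ λ_Φ`, followed by g18-#2's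
`X^*(S^K) ↪ ℤ[Γ]`, equals g17-#4's `orbitToS : CharModule ℤ (c.orbit) ι → ℤ[Γ]`, `[δ_Φ] ↦ 𝟙_Φ` (as `λ_Φ ↦ 𝟙_{Φ on Γ}`, g18-#3
`toGroupRing_cmTypeChar`). [cite: Milne1999, §6 p. 71 L16 (Lemma 6.10, `γ`); §3 p. 59 L1–L8] -/
theorem toGroupRing_comp_gammaCharK :
    (toGroupRing τ₀).comp ((infinityTypes (cmNumbers ≃ₐ[ℚ] cmNumbers) (K →ₐ[ℚ] cmNumbers) cmNumbersConj).subtype.comp (gammaCharK hΦ₀)) =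
      (CosetGerm.orbitToS ℤ h two_ne_zero (cmOrbitClass τ₀ h hΦ₀)).comp (cmOrbitCharEquivModel τ₀ h hΦ₀).toLinearMap := by
  apply Submodule.linearMap_qext
  apply Finsupp.lhom_ext'
  intro Φ
  apply LinearMap.ext_ring
  change toGroupRing τ₀ ((gammaCharK hΦ₀ (Submodule.Quotient.mk (Finsupp.single Φ 1)) : (K →ₐ[ℚ] cmNumbers) → ℤ)) =
    CosetGerm.orbitToS ℤ h two_ne_zero (cmOrbitClass τ₀ h hΦ₀) (cmOrbitCharEquivModel τ₀ h hΦ₀ (Submodule.Quotient.mk (Finsupp.single Φ 1)))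
  rw [gammaCharK_mk_single, toGroupRing_cmTypeChar, cmOrbitCharEquivModel_mk_single, CosetGerm.orbitToS_mk_single, coe_cmOrbitMap]

/-- The same on elements: `Σ_σ (γ^Ψ x)(τ₀σ)σ = orbitToS (x read on Γ)`. [cite: Milne1999, §6 p. 71 L16; §3 p. 59 L1–L8] -/
theorem toGroupRing_gammaCharK (x : cmOrbitChar ℤ Φ₀) :
    toGroupRing τ₀ ((gammaCharK hΦ₀ x) : (K →ₐ[ℚ] cmNumbers) → ℤ) =
      CosetGerm.orbitToS ℤ h two_ne_zero (cmOrbitClass τ₀ h hΦ₀) (cmOrbitCharEquivModel τ₀ h hΦ₀ x) :=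
  LinearMap.congr_fun (toGroupRing_comp_gammaCharK τ₀ h hΦ₀) x

/-- Through `X^*(S^K) ≅ serreLattice` (g18-#2 `serreLatticeEquiv`). [cite: Milne1999, §6 p. 71 L16] -/
theorem coe_serreLatticeEquiv_gammaCharK (x : cmOrbitChar ℤ Φ₀) :
    (serreLatticeEquiv τ₀ (gammaCharK hΦ₀ x) : (K ≃ₐ[ℚ] K) →₀ ℤ) =
      CosetGerm.orbitToS ℤ h two_ne_zero (cmOrbitClass τ₀ h hΦ₀) (cmOrbitCharEquivModel τ₀ h hΦ₀ x) := by
  rw [coe_serreLatticeEquiv, toGroupRing_gammaCharK]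

end TSide

/-! ### §2 The `L`-side: `Π(Ψ)(K) ≃ Π(model)`, `X^*(L^Π)(K) ≅ CharModule ℤ Π ι`, `l^Π ↦ l`, `X^*(β^Π)(K)` IS `orbitToP`, `X^*(α′)(K)` IS `pushOrbit` -/

section LSide

variable {K : Type} [Field K] [NumberField K] [IsCMField K] [IsGalois ℚ K]
variable (p : ℕ) [hp : Fact p.Prime] (𝔭 : Ideal (𝓞 K)) [h𝔭P : 𝔭.IsPrime] [h𝔭 : 𝔭.LiesOver (Ideal.span {(p : ℤ)})]
variable (τ₀ : K →ₐ[ℚ] cmNumbers)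
variable {Γ₀ : Subgroup (K ≃ₐ[ℚ] K)} (h : Setting (conjGal : K ≃ₐ[ℚ] K) Γ₀ (decompositionGroup p 𝔭)) [DecidableEq (K ≃ₐ[ℚ] K)]
variable {Φ₀ : Set (K →ₐ[ℚ] cmNumbers)} (hΦ₀ : IsCMTypeWith (cmNumbersConj : cmNumbers ≃ₐ[ℚ] cmNumbers) Φ₀)

/-- **The class of `Π(Ψ) = Γπ(Φ₀)` in `I′ = Γ\W^K_{1,+}(p^∞)`** (g17-#4 `WeilOrbits`, via `redI : I → I′`): the class of `red(Φ₀ on Γ) = f_{π(Φ₀)}`.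
[cite: Milne1999, §6 p. 71 L15 («let I′ = Γ\W^K_{1,+}(p^∞)»)] -/
def weilOrbitClass : WeilOrbits ℤ h := CosetGerm.redI ℤ h (cmOrbitClass τ₀ h hΦ₀)

omit [IsGalois ℚ K] hp in
/-- [cite: Milne1999, §6 p. 71 L15] -/
theorem weilOrbitClass_eq : weilOrbitClass p 𝔭 τ₀ h hΦ₀ = Quotient.mk'' (red ℤ h (toCMTypes τ₀ h hΦ₀)) := rfl

omit [DecidableEq (K ≃ₐ[ℚ] K)] in
/-- `σ′x` read in `X^*(P^K)` is `σ′` applied to `x` read in `X^*(P^K)` (g16-#3 `weilLimitInRep`). [cite: Milne1999, §4 p. 61 L20–L21] -/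
theorem ofMul_smul_eq_weilLimitInRep (σ' : cmNumbers ≃ₐ[ℚ] cmNumbers) (x : WeilLimit p) (hx : x ∈ weilLimitIn K p τ₀)
    (hx' : σ' • x ∈ weilLimitIn K p τ₀) :
    Additive.ofMul (⟨σ' • x, hx'⟩ : weilLimitIn K p τ₀) = weilLimitInRep p τ₀ σ' (Additive.ofMul ⟨x, hx⟩) := rfl

omit [DecidableEq (K ≃ₐ[ℚ] K)] in
/-- **`f_{π(Φ)} = red(Φ on Γ)`** for every CM type `Φ` of `K`, as an identity in `ℤ[Γ/D]` (g18-#3 `coe_red_toCMTypes`, g16-#7 `alphaCharIn_cmTypeChar`).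
[cite: Milne1999, §6 p. 69 L18–L21, §5 pp. 64–65] -/
theorem germToCosetFun_ofMul_cmTypeGerm {Φ : Set (K →ₐ[ℚ] cmNumbers)} (hΦ : IsCMTypeWith (cmNumbersConj : cmNumbers ≃ₐ[ℚ] cmNumbers) Φ)
    (hx : cmTypeGerm p 𝔭 hΦ ∈ weilLimitIn K p τ₀) :
    germToCosetFun p 𝔭 τ₀ (Additive.ofMul ⟨cmTypeGerm p 𝔭 hΦ, hx⟩) = (red ℤ h (toCMTypes τ₀ h hΦ)).1 := by
  rw [coe_red_toCMTypes p 𝔭 τ₀ h hΦ]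
  rfl

omit [IsGalois ℚ K] hp in
/-- The model orbit class `[red(Φ₀ on Γ)]` as a set is the `Γ`-orbit of `red(Φ₀ on Γ)`. [cite: Milne1999, §6 p. 71 L15] -/
theorem orbit_weilOrbitClass_eq :
    MulAction.orbitRel.Quotient.orbit (weilOrbitClass p 𝔭 τ₀ h hΦ₀) = MulAction.orbit (K ≃ₐ[ℚ] K) (red ℤ h (toCMTypes τ₀ h hΦ₀)) := rfl

omit [IsGalois ℚ K] hp in
/-- `red(Φ₀ on Γ)` lies in the model orbit class `[red(Φ₀ on Γ)]`. [cite: Milne1999, §6 p. 71 L15] -/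
theorem red_toCMTypes_mem_orbit_weilOrbitClass :
    red ℤ h (toCMTypes τ₀ h hΦ₀) ∈ MulAction.orbitRel.Quotient.orbit (weilOrbitClass p 𝔭 τ₀ h hΦ₀) := by
  rw [orbit_weilOrbitClass_eq]
  exact MulAction.mem_orbit_self _

/-- **`f_{σ′π(Φ₀)} = ρ·red(Φ₀ on Γ)`** for `σ′ ∘ τ₀ = τ₀ ∘ ρ`: the germ of an element of the orbit `Π = Gal(ℚ^{cm}/ℚ)·π(Φ₀)`, read in `ℤ[Γ/D]`.
[cite: Milne1999, §6 p. 71 L15–L17, p. 70 L11] -/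
theorem germToCosetFun_ofMul_orbit (π : MulAction.orbit (cmNumbers ≃ₐ[ℚ] cmNumbers) (cmTypeGerm p 𝔭 hΦ₀))
    (σ' : cmNumbers ≃ₐ[ℚ] cmNumbers) (hσ' : σ' • cmTypeGerm p 𝔭 hΦ₀ = π) (ρ : K ≃ₐ[ℚ] K) (hρ : σ' • τ₀ = embOfAut τ₀ ρ) :
    germToCosetFun p 𝔭 τ₀ (Additive.ofMul ⟨(π : WeilLimit p),
        coe_orbit_mem_weilLimitIn p τ₀ (cmTypeGerm_mem_weilLimitInOnePlus p 𝔭 τ₀ hΦ₀).1 π⟩) =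
      (ρ • red ℤ h (toCMTypes τ₀ h hΦ₀)).1 := by
  have e : Additive.ofMul (⟨(π : WeilLimit p), coe_orbit_mem_weilLimitIn p τ₀ (cmTypeGerm_mem_weilLimitInOnePlus p 𝔭 τ₀ hΦ₀).1 π⟩ :
      weilLimitIn K p τ₀) = weilLimitInRep p τ₀ σ' (Additive.ofMul ⟨cmTypeGerm p 𝔭 hΦ₀, (cmTypeGerm_mem_weilLimitInOnePlus p 𝔭 τ₀ hΦ₀).1⟩) := by
    rw [weilLimitInRep_apply]
    exact congrArg Additive.ofMul (Subtype.ext (by rw [coe_weilLimitInAct]; exact hσ'.symm))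
  rw [e, germToCosetFun_weilLimitInRep p 𝔭 τ₀ σ' ρ hρ, germToCosetFun_ofMul_cmTypeGerm p 𝔭 τ₀ h hΦ₀, CosetGerm.WeilGerms.coe_smul]

/-- **`Π(Ψ)(K) → Π(model)`, `π ↦ f_π`**: a germ `π` of the orbit `Π = Gal(ℚ^{cm}/ℚ)·π(Φ₀) ⊂ W(p^∞)` goes to its `f_π ∈ ℤ[Γ/D]` (g18-#2
`germToCosetFun`), an element of the model orbit class `[red(Φ₀ on Γ)]`. [cite: Milne1999, §6 p. 71 L15–L17, p. 70 L11 («sends π to the map σ ↦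
f_π(σw₀)»)] -/
def weilOrbitMap (π : MulAction.orbit (cmNumbers ≃ₐ[ℚ] cmNumbers) (cmTypeGerm p 𝔭 hΦ₀)) :
    MulAction.orbitRel.Quotient.orbit (weilOrbitClass p 𝔭 τ₀ h hΦ₀) :=
  ⟨⟨germToCosetFun p 𝔭 τ₀ (Additive.ofMul ⟨(π : WeilLimit p),
      coe_orbit_mem_weilLimitIn p τ₀ (cmTypeGerm_mem_weilLimitInOnePlus p 𝔭 τ₀ hΦ₀).1 π⟩), by
    obtain ⟨σ', hσ'⟩ := MulAction.mem_orbit_iff.mp π.2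
    obtain ⟨ρ, hρ⟩ := exists_smul_eq_embOfAut τ₀ σ'
    exact ⟨ρ • toCMTypes τ₀ h hΦ₀, by
      rw [germToCosetFun_ofMul_orbit p 𝔭 τ₀ h hΦ₀ π σ' hσ' ρ hρ, ← CosetGerm.red_smul, CosetGerm.coe_red]⟩⟩, by
    obtain ⟨σ', hσ'⟩ := MulAction.mem_orbit_iff.mp π.2
    obtain ⟨ρ, hρ⟩ := exists_smul_eq_embOfAut τ₀ σ'
    rw [orbit_weilOrbitClass_eq]
    exact MulAction.mem_orbit_iff.2 ⟨ρ, CosetGerm.WeilGerms.ext ℤ h (germToCosetFun_ofMul_orbit p 𝔭 τ₀ h hΦ₀ π σ' hσ' ρ hρ).symm⟩⟩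

/-- `(f read in the model).1 = f_π`. [cite: Milne1999, §6 p. 71 L17, p. 70 L11] -/
@[simp] theorem coe_coe_weilOrbitMap (π : MulAction.orbit (cmNumbers ≃ₐ[ℚ] cmNumbers) (cmTypeGerm p 𝔭 hΦ₀)) :
    ((weilOrbitMap p 𝔭 τ₀ h hΦ₀ π : MulAction.orbitRel.Quotient.orbit (weilOrbitClass p 𝔭 τ₀ h hΦ₀)) : WeilGerms ℤ h).1 =
      germToCosetFun p 𝔭 τ₀ (Additive.ofMul ⟨(π : WeilLimit p),
        coe_orbit_mem_weilLimitIn p τ₀ (cmTypeGerm_mem_weilLimitInOnePlus p 𝔭 τ₀ hΦ₀).1 π⟩) := rfl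

/-- **Equivariance along restriction**: `σ″π ↦ ρ″·f_π` for `σ″ ∘ τ₀ = τ₀ ∘ ρ″` (g18-#4 `germToCosetFun_weilLimitInRep`). [cite: Milne1999, §6 p. 71
L15–L17] -/
theorem weilOrbitMap_smul (σ'' : cmNumbers ≃ₐ[ℚ] cmNumbers) (ρ'' : K ≃ₐ[ℚ] K) (hρ'' : σ'' • τ₀ = embOfAut τ₀ ρ'')
    (π : MulAction.orbit (cmNumbers ≃ₐ[ℚ] cmNumbers) (cmTypeGerm p 𝔭 hΦ₀)) :
    weilOrbitMap p 𝔭 τ₀ h hΦ₀ (σ'' • π) = ρ'' • weilOrbitMap p 𝔭 τ₀ h hΦ₀ π := by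
  apply Subtype.ext
  apply CosetGerm.WeilGerms.ext ℤ h
  rw [MulAction.orbitRel.Quotient.orbit.coe_smul, CosetGerm.WeilGerms.coe_smul, coe_coe_weilOrbitMap, coe_coe_weilOrbitMap,
    ← germToCosetFun_weilLimitInRep p 𝔭 τ₀ σ'' ρ'' hρ'', ← ofMul_smul_eq_weilLimitInRep p τ₀ σ'']
  rfl

/-- `ι_{cm}π ↦ ι·f_π`. [cite: Milne1999, §6 p. 71 L15–L17] -/
theorem weilOrbitMap_conj_smul (π : MulAction.orbit (cmNumbers ≃ₐ[ℚ] cmNumbers) (cmTypeGerm p 𝔭 hΦ₀)) :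
    weilOrbitMap p 𝔭 τ₀ h hΦ₀ (cmNumbersConj • π) = (conjGal : K ≃ₐ[ℚ] K) • weilOrbitMap p 𝔭 τ₀ h hΦ₀ π :=
  weilOrbitMap_smul p 𝔭 τ₀ h hΦ₀ cmNumbersConj conjGal (cmNumbersConj_smul_eq_embOfAut_conjGal τ₀) π

/-- The base point: `π(Φ₀) ↦ red(Φ₀ on Γ)`. [cite: Milne1999, §6 p. 71 L15–L17] -/
theorem weilOrbitMap_base :
    weilOrbitMap p 𝔭 τ₀ h hΦ₀ ⟨cmTypeGerm p 𝔭 hΦ₀, MulAction.mem_orbit_self _⟩ =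
      ⟨red ℤ h (toCMTypes τ₀ h hΦ₀), red_toCMTypes_mem_orbit_weilOrbitClass p 𝔭 τ₀ h hΦ₀⟩ :=
  Subtype.ext (CosetGerm.WeilGerms.ext ℤ h (by rw [coe_coe_weilOrbitMap]; exact germToCosetFun_ofMul_cmTypeGerm p 𝔭 τ₀ h hΦ₀ _))

/-- `π ↦ f_π` is injective on `Π` («it is injective (Section 4)», g18-#2 `germToCosetFun_injective`). [cite: Milne1999, §6 p. 70 L11] -/
theorem weilOrbitMap_injective : Function.Injective (weilOrbitMap p 𝔭 τ₀ h hΦ₀) := by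
  intro π π' e
  have e' := congrArg (fun w : MulAction.orbitRel.Quotient.orbit (weilOrbitClass p 𝔭 τ₀ h hΦ₀) => (w : WeilGerms ℤ h).1) e
  simp only [coe_coe_weilOrbitMap] at e'
  exact Subtype.ext (congrArg (fun x : weilLimitIn K p τ₀ => (x : WeilLimit p)) (Additive.ofMul.injective (germToCosetFun_injective p 𝔭 τ₀ e')))

/-- `π ↦ f_π` maps `Π` onto the model orbit class (every `ρ ∈ Γ` is a restriction). [cite: Milne1999, §6 p. 71 L15–L17] -/
theorem weilOrbitMap_surjective : Function.Surjective (weilOrbitMap p 𝔭 τ₀ h hΦ₀) := by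
  rintro ⟨w, hw⟩
  obtain ⟨ρ, rfl⟩ := MulAction.mem_orbit_iff.mp (show w ∈ MulAction.orbit (K ≃ₐ[ℚ] K) (red ℤ h (toCMTypes τ₀ h hΦ₀)) from hw)
  obtain ⟨σ', hσ'⟩ := exists_smul_eq_embOfAut' τ₀ ρ
  refine ⟨σ' • ⟨cmTypeGerm p 𝔭 hΦ₀, MulAction.mem_orbit_self _⟩, ?_⟩
  rw [weilOrbitMap_smul p 𝔭 τ₀ h hΦ₀ σ' ρ hσ', weilOrbitMap_base]
  rfl

/-- **`Π(Ψ)(K) ≃ Π(model)`**: the `Gal(ℚ^{cm}/ℚ)`-orbit of the germ `π(Φ₀) ∈ W(p^∞)` IS, through `π ↦ f_π`, the `Γ`-orbit class of `red(Φ₀ on Γ)` in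
g17-#4's `I′ = Γ\W^K_{1,+}(p^∞)`, compatibly with `ι_{cm} ↦ ι` and restriction. [cite: Milne1999, §6 p. 71 L15–L17, p. 70 L11] -/
def weilOrbitEquiv :
    MulAction.orbit (cmNumbers ≃ₐ[ℚ] cmNumbers) (cmTypeGerm p 𝔭 hΦ₀) ≃ MulAction.orbitRel.Quotient.orbit (weilOrbitClass p 𝔭 τ₀ h hΦ₀) :=
  Equiv.ofBijective (weilOrbitMap p 𝔭 τ₀ h hΦ₀) ⟨weilOrbitMap_injective p 𝔭 τ₀ h hΦ₀, weilOrbitMap_surjective p 𝔭 τ₀ h hΦ₀⟩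

/-- [cite: Milne1999, §6 p. 71 L15–L17] -/
@[simp] theorem weilOrbitEquiv_apply (π : MulAction.orbit (cmNumbers ≃ₐ[ℚ] cmNumbers) (cmTypeGerm p 𝔭 hΦ₀)) :
    weilOrbitEquiv p 𝔭 τ₀ h hΦ₀ π = weilOrbitMap p 𝔭 τ₀ h hΦ₀ π := rfl

/-- **`Ψ → Π(Ψ)` of `K` IS the model's `redOrbit`**: reading `π(Φ)` in the model gives `red(Φ on Γ)` (g16-#6 `orbitRed` ↔ g17-#4 `redOrbit`).
[cite: Milne1999, §5 pp. 64–65 («The reduction functor»), §6 p. 71 L16–L17 (`α″`)] -/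
theorem weilOrbitMap_orbitRed (Φ : MulAction.orbit (cmNumbers ≃ₐ[ℚ] cmNumbers) Φ₀) :
    weilOrbitMap p 𝔭 τ₀ h hΦ₀ (orbitRed p 𝔭 hΦ₀ Φ) = CosetGerm.redOrbit ℤ h (cmOrbitClass τ₀ h hΦ₀) (cmOrbitMap τ₀ h hΦ₀ Φ) :=
  Subtype.ext (CosetGerm.WeilGerms.ext ℤ h (by
    rw [coe_coe_weilOrbitMap, CosetGerm.coe_redOrbit, coe_cmOrbitMap]
    exact germToCosetFun_ofMul_cmTypeGerm p 𝔭 τ₀ h (isCMTypeWith_of_mem_orbit hΦ₀ Φ) _))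

/-- **`X^*(L^Π)(K) IS THE MODEL'S `X^*(L^Π)`** for every orbit `Π = Π(Ψ)`: g15-#3's `weilOrbitChar ℤ (π(Φ₀)) = {f : Π → ℤ}/{f = ιf, Σ f = 0}` is, along
`Π(K) ≃ Π(model)`, g17-#4's summand `CharModule ℤ (c′.orbit) ι` of `⊕_{Π∈I′} X^*(L^Π)` at `c′ = [red(Φ₀ on Γ)]`. [cite: Milne1999, §6 p. 71 L15–L17;
§4 p. 60 L22–L27] -/
def weilOrbitCharEquivModel :
    weilOrbitChar ℤ (cmTypeGerm p 𝔭 hΦ₀) ≃ₗ[ℤ]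
      OrbitTorus.CharModule ℤ (MulAction.orbitRel.Quotient.orbit (weilOrbitClass p 𝔭 τ₀ h hΦ₀)) (conjGal : K ≃ₐ[ℚ] K) :=
  OrbitTorus.congr₂ ℤ cmNumbersConj (conjGal : K ≃ₐ[ℚ] K) (weilOrbitEquiv p 𝔭 τ₀ h hΦ₀) (weilOrbitMap_conj_smul p 𝔭 τ₀ h hΦ₀)

/-- `[δ_π] ↦ [δ_{f_π}]`. [cite: Milne1999, §6 p. 71 L15–L17] -/
theorem weilOrbitCharEquivModel_mk_single (π : MulAction.orbit (cmNumbers ≃ₐ[ℚ] cmNumbers) (cmTypeGerm p 𝔭 hΦ₀)) (r : ℤ) :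
    weilOrbitCharEquivModel p 𝔭 τ₀ h hΦ₀ (Submodule.Quotient.mk (Finsupp.single π r)) =
      Submodule.Quotient.mk (Finsupp.single (weilOrbitMap p 𝔭 τ₀ h hΦ₀ π) r) :=
  OrbitTorus.congr₂_mk_single ℤ _ _ _ _ π r

/-- **`l^Π ↦ l`**: `lWeil = [π(Φ₀) + ιπ(Φ₀)]` goes to `[δ_{red Φ₀} + δ_{ι red Φ₀}]`. [cite: Milne1999, §6 p. 71 L15–L17; §4 p. 60 L25–L27] -/
theorem weilOrbitCharEquivModel_lWeil :
    weilOrbitCharEquivModel p 𝔭 τ₀ h hΦ₀ (lWeil ℤ (cmTypeGerm p 𝔭 hΦ₀)) =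
      OrbitTorus.tChar ℤ (conjGal : K ≃ₐ[ℚ] K) (⟨red ℤ h (toCMTypes τ₀ h hΦ₀), red_toCMTypes_mem_orbit_weilOrbitClass p 𝔭 τ₀ h hΦ₀⟩ :
        MulAction.orbitRel.Quotient.orbit (weilOrbitClass p 𝔭 τ₀ h hΦ₀)) := by
  have e2 := OrbitTorus.congr₂_tChar ℤ cmNumbersConj (conjGal : K ≃ₐ[ℚ] K) (weilOrbitEquiv p 𝔭 τ₀ h hΦ₀)
    (weilOrbitMap_conj_smul p 𝔭 τ₀ h hΦ₀) ⟨cmTypeGerm p 𝔭 hΦ₀, MulAction.mem_orbit_self _⟩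
  rw [weilOrbitEquiv_apply, weilOrbitMap_base] at e2
  exact e2

/-- **Equivariance** along `σ′ ↦ σ′|_K` (g15-#3 `weilOrbitRep` ↔ Q731 `OrbitTorus.rep`). [cite: Milne1999, §6 p. 71 L15–L17] -/
theorem weilOrbitCharEquivModel_weilOrbitRep (σ' : cmNumbers ≃ₐ[ℚ] cmNumbers) (ρ : K ≃ₐ[ℚ] K) (hρ : σ' • τ₀ = embOfAut τ₀ ρ)
    (x : weilOrbitChar ℤ (cmTypeGerm p 𝔭 hΦ₀)) :
    weilOrbitCharEquivModel p 𝔭 τ₀ h hΦ₀ (weilOrbitRep ℤ (cmTypeGerm p 𝔭 hΦ₀) σ' x) =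
      OrbitTorus.rep ℤ (MulAction.orbitRel.Quotient.orbit (weilOrbitClass p 𝔭 τ₀ h hΦ₀)) (conjGal : K ≃ₐ[ℚ] K) h.comm ρ
        (weilOrbitCharEquivModel p 𝔭 τ₀ h hΦ₀ x) :=
  OrbitTorus.congr₂_rep ℤ _ _ _ _ cmNumbersConj_mul_comm h.comm (weilOrbitMap_smul p 𝔭 τ₀ h hΦ₀ σ' ρ hρ) x

/-- **`X^*(β^Π)(K)` IS THE MODEL'S `X^*(L^{c′}) → X^*(P^K)`**: g16-#7's `betaCharIn : X^*(L^Π) → X^*(P^K)`, `[δ_π] ↦ π`, followed by g18-#2's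
`π ↦ f_π`, equals g17-#4's `orbitToP : CharModule ℤ (c′.orbit) ι → ℤ[Γ/D]`, `[δ_π] ↦ f_π`. [cite: Milne1999, §6 p. 71 L17 (Lemma 6.10, `β`); §4 p. 62
L17–L19] -/
theorem germToCosetFun_comp_betaCharIn :
    (germToCosetFun p 𝔭 τ₀).comp (betaCharIn p τ₀ (cmTypeGerm p 𝔭 hΦ₀) (cmTypeGerm_mem_weilLimitInOnePlus p 𝔭 τ₀ hΦ₀)) =
      (CosetGerm.orbitToP ℤ h two_ne_zero (weilOrbitClass p 𝔭 τ₀ h hΦ₀)).comp (weilOrbitCharEquivModel p 𝔭 τ₀ h hΦ₀).toLinearMap := by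
  apply Submodule.linearMap_qext
  apply Finsupp.lhom_ext'
  intro π
  apply LinearMap.ext_ring
  change germToCosetFun p 𝔭 τ₀ (betaCharIn p τ₀ (cmTypeGerm p 𝔭 hΦ₀) (cmTypeGerm_mem_weilLimitInOnePlus p 𝔭 τ₀ hΦ₀)
      (Submodule.Quotient.mk (Finsupp.single π 1))) =
    CosetGerm.orbitToP ℤ h two_ne_zero (weilOrbitClass p 𝔭 τ₀ h hΦ₀)
      (weilOrbitCharEquivModel p 𝔭 τ₀ h hΦ₀ (Submodule.Quotient.mk (Finsupp.single π 1)))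
  rw [betaCharIn_mk_single, weilOrbitCharEquivModel_mk_single, CosetGerm.orbitToP_mk_single, coe_coe_weilOrbitMap]

/-- The same on elements: `f_{β^Π(x)} = orbitToP (x read in the model)`. [cite: Milne1999, §6 p. 71 L17] -/
theorem germToCosetFun_betaCharIn_eq_orbitToP (x : weilOrbitChar ℤ (cmTypeGerm p 𝔭 hΦ₀)) :
    germToCosetFun p 𝔭 τ₀ (betaCharIn p τ₀ (cmTypeGerm p 𝔭 hΦ₀) (cmTypeGerm_mem_weilLimitInOnePlus p 𝔭 τ₀ hΦ₀) x) =
      CosetGerm.orbitToP ℤ h two_ne_zero (weilOrbitClass p 𝔭 τ₀ h hΦ₀) (weilOrbitCharEquivModel p 𝔭 τ₀ h hΦ₀ x) :=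
  LinearMap.congr_fun (germToCosetFun_comp_betaCharIn p 𝔭 τ₀ h hΦ₀) x

/-- **`X^*(α′)(K)` IS THE MODEL'S `pushOrbit`**: g16-#6's `redChar : X^*(T^Ψ) → X^*(L^{Π(Ψ)})` (`[δ_Φ] ↦ [δ_{π(Φ)}]`) read in the model is g17-#4's
`pushOrbit c : CharModule ℤ (c.orbit) ι → CharModule ℤ ((redI c).orbit) ι` (the summand of `α″`). [cite: Milne1999, §6 p. 71 L16–L17 (Lemma 6.10,
`α″`); §5 pp. 64–65] -/
theorem weilOrbitCharEquivModel_comp_redChar :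
    (weilOrbitCharEquivModel p 𝔭 τ₀ h hΦ₀).toLinearMap.comp (redChar p 𝔭 hΦ₀) =
      (CosetGerm.pushOrbit ℤ h (cmOrbitClass τ₀ h hΦ₀)).comp (cmOrbitCharEquivModel τ₀ h hΦ₀).toLinearMap := by
  apply Submodule.linearMap_qext
  apply Finsupp.lhom_ext'
  intro Φ
  apply LinearMap.ext_ring
  change weilOrbitCharEquivModel p 𝔭 τ₀ h hΦ₀ (redChar p 𝔭 hΦ₀ (Submodule.Quotient.mk (Finsupp.single Φ 1))) =
    CosetGerm.pushOrbit ℤ h (cmOrbitClass τ₀ h hΦ₀) (cmOrbitCharEquivModel τ₀ h hΦ₀ (Submodule.Quotient.mk (Finsupp.single Φ 1)))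
  rw [redChar_mk_single, weilOrbitCharEquivModel_mk_single, weilOrbitMap_orbitRed, cmOrbitCharEquivModel_mk_single, CosetGerm.pushOrbit_mk,
    OrbitTorus.pushFun_single]
  rfl

/-- The same on elements. [cite: Milne1999, §6 p. 71 L16–L17] -/
theorem weilOrbitCharEquivModel_redChar (x : cmOrbitChar ℤ Φ₀) :
    weilOrbitCharEquivModel p 𝔭 τ₀ h hΦ₀ (redChar p 𝔭 hΦ₀ x) =
      CosetGerm.pushOrbit ℤ h (cmOrbitClass τ₀ h hΦ₀) (cmOrbitCharEquivModel τ₀ h hΦ₀ x) :=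
  LinearMap.congr_fun (weilOrbitCharEquivModel_comp_redChar p 𝔭 τ₀ h hΦ₀) x

end LSide

end CMNumbers

end Literature.NumberTheory.ComplexMultiplication
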